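import Literature.AlgebraicGeometry.HodgeTheory.PolarizationClassRosatiAdjoint
import HarnessLib

/-!
# The Rosati adjoint on `H¹(A(ℂ); ℂ)`: uniqueness, additivity, anti-multiplicativity, involutivity, and — on the
# centre of `End⁰(A)` — independence of the polarization class

Layer `Literature/AlgebraicGeometry/HodgeTheory`; THEOREMS ONLY — no definition, no named fact, no `sorry` (D-0026, net
debt 0).  Sequel of `PolarizationClassRosatiAdjoint` (g28-#2: for a polarization class `h` — rational, `(1,1)`, hard
Lefschetz — every `φ ∈ End(A)` has a ROSATI PAIR `(kφ, φ')`, `k ∈ ℤ ∖ 0`, `φ' ∈ End(A)`, meaning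
`Q_h((kφ)^* x, y) = Q_h(x, φ'^* y)` on `H¹(A(ℂ); ℂ)`).  This file records the algebra of Rosati pairs that makes
`φ ↦ φ'` «an anti-involution of `End⁰(A)`» (Mumford §20: `(φ + ψ)' = φ' + ψ'`, `(φψ)' = ψ'φ'`, `φ'' = φ`; Lange–Birkenhake
Thm. 5.1.8), entirely on the carrier and for ANY class `h` with `Q_h` non-degenerate (§2), and proves that ON THE CENTRE
the Rosati adjoint does not depend on the polarization class (§3): for the central generator `ψ` (`R(ψ) = 0`, `R`
irreducible over `ℚ`) and two classes `h₁`, `h₂` with non-degenerate Hodge–Riemann-positive `Q_{h₁}`, `Q_{h₂}`, Rosati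
images `ψ₁', ψ₂' ∈ ℚ(ψ)` of `ψ` coincide — both act on `V_τ(ψ)` by `τ̄` («`†` is complex conjugation on `E`», Lange
Lemma 2.6.6 / Shimura §5.1 Lemma 2: `ξ^{ρτ} = \overline{ξ^τ}` for every embedding `τ`, which pins `ρ|_K` down).

## The print

D. Mumford, *Abelian Varieties* (1970) [MumfordAV1970], §20 pp. 189–190 (the Rosati involution: `ℚ`-linear
anti-automorphism of `End⁰(X)` with `φ'' = φ`, `E(φx, y) = E(x, φ'y)`); H. Lange, Ch. Birkenhake, *Complex Abelian
Varieties* [LangeBirkenhake1992], §5.1 Prop. 5.1.1 (Rosati = adjoint for the Riemann form) and Thm. 5.1.8 (anti-involution);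
H. Lange, *Abelian Varieties over the Complex Numbers* (2023) [Lange2023AbelianVarietiesC] §2.6 Lemma 2.6.6 and
Thm. 2.6.8 (held p0144: on the centre of a pair of the second kind the anti-involution is complex conjugation);
G. Shimura (1998) [Shimura1998] §5.1 Lemma 2 (p. 35) and Prop. 5 (proof, p. 36); B. J. J. Moonen, Yu. G. Zarhin
[MoonenZarhin1998WeilClasses] §1 (chunk p0002 L45–L51: «`†` the involution … everything only depends on `X` up to
isogeny», «`G_div(X)` … does not depend on the choice of `λ`»).

## What is proved (sorry-free)

§1 `AbelianVariety.hom_eq_of_pullbackOne_eq` — `φ^* = χ^*` on `H¹(A(ℂ); ℂ)` ⟹ `φ = χ` (faithfulness, via `H¹(ℚ) ↪ H¹(ℂ)`).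
§2 for `Q_h` non-degenerate: **`rosati_adjoint_unique`**, `rosati_adjoint_swap` (the pair `(φ', kφ)`: «`φ'' = φ`»),
`rosati_adjoint_add`, `rosati_adjoint_zsmul`, **`rosati_adjoint_comp`** (pairs `(k₁φ₁, φ₁')`, `(k₂φ₂, φ₂')` ⟹
`((k₁k₂)(φ₁ ≫ φ₂), φ₂' ≫ φ₁')`), `rosati_adjoint_zsmul_id`, **`rosati_adjoint_rosati_adjoint`** (`(kφ, φ')`, `(k'φ', φ'')`
⟹ `φ'' = k'kφ`).
§3 **`rosati_adjoint_central_eq_of_two_classes`** — `Q_{h₁}`, `Q_{h₂}` non-degenerate and Hodge–Riemann positive,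
`R(ψ) = 0` irreducible over `ℚ`, `(ψ, ψ₁')` a `Q_{h₁}`-pair and `(ψ, ψ₂')` a `Q_{h₂}`-pair with `Nᵢψᵢ' ∈ ℤ[ψ]` ⟹ `ψ₁' = ψ₂'`;
**`rosati_adjoint_central_eq_of_two_polarizationClasses`** — the same for two polarization classes (rational, `(1,1)`,
hard Lefschetz, Hodge–Riemann positive) and the `End(A)`-level presentation of the centre (`ψ` central, `R(ψ) = 0`,
every central `g` with `N g ∈ ℤ[ψ]`): the memberships `Nᵢψᵢ' ∈ ℤ[ψ]` are then automatic (g28-#2's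
`exists_zsmul_rosati_adjoint_mem_closure`).
§4 **`hasNoTypeIVFactor_iff_forall_central_rosati_adjoint_eq`** — for any polarization class: `HasNoTypeIVFactor A` iff
every Rosati pair `(kφ, φ')` with `φ` central has `φ' = kφ` («first kind»);
`not_hasNoTypeIVFactor_iff_exists_central_rosati_adjoint_ne` («second kind»).

## Relation to the tree

* `Milne1999/LefschetzCentraliserRosatiInvolution` (Milne §1 p. 642–643) has the `ℂ`-LINEAR carrier adjoint `T ↦ T†` of an
  arbitrary endomorphism `T` of `H¹(A(ℂ); ℂ)` for a Kähler-multiple class (`exists_adjoint_polarizationPairingOne`,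
  `adjoint_mul_polarizationPairingOne`, `adjoint_adjoint_polarizationPairingOne`) and proves that the adjoint of `φ^*`
  lies in the `ℂ`-SPAN of the pull-backs (`adjoint_pullbackOne_mem_span_pullbackOne`).  g28-#2's
  `exists_rosati_adjoint_pullbackOne` is the RATIONAL sharpening (the adjoint of `(kφ)^*` IS a pull-back `φ'^*`,
  `φ' ∈ End(A)`), and §2 below is the corresponding algebra for such `End(A)`-valued pairs; §3–§4 are new.

## Honest column

* No `ℚ`-algebra anti-involution `End⁰(A) → End⁰(A)` is CONSTRUCTED here (no definition); the tree's
  `AbelianVariety.rosati` (file `QuaternionMinimalPowersHodgeClasses`, `BettiUniverse` vocabulary, for a `Polarization`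
  of `BettiUniverse.hodge … 1`) is that object, and its identification with the present carrier pairs is not made here.
* Positivity of the Rosati involution (`Tr(φφ') > 0`, Mumford §21 Thm. 1) is not treated.

## Provenance

Lane `lit-hodgefound` (Track 2, Layer A), prover seat `lit-hodgefound-p21` (generation 28), row g28-#5.
-/

noncomputable section

open CategoryTheory CategoryTheory.Limits Polynomial Module
open Literature.AlgebraicTopology.SingularHomology
open Literature.AlgebraicGeometry.Motives
open Literature.AlgebraicGeometry.VanGeemen1994 (hodgeClassSpan pullbackOne)
open Literature.AlgebraicGeometry.Milne1999
open Literature.AlgebraicGeometry.ComplexMultiplication (CenterField)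
open Literature.Geometry.Kaehler (lefschetzPow HasHardLefschetzProperty)

namespace Literature.AlgebraicGeometry.HodgeTheory

/-! ### §1 Faithfulness: `φ ↦ φ^*` on `H¹(A(ℂ); ℂ)` is injective -/

section Faithful

variable {A : AbelianVariety ℂ}

/-- **`φ^* = χ^*` on `H¹(A(ℂ); ℂ)` forces `φ = χ`** (the rational representation is faithful, Mumford §19 Thm. 3 /
Lange–Birkenhake Prop. 1.2.?; here: `H¹(A(ℂ); ℚ) ↪ H¹(A(ℂ); ℂ)` by `ofRatClass_injective` and the tree's
`AbelianVariety.hom_eq_of_bettiCohomology_map_one_eq`). [cite: MumfordAV1970, §19 Thm. 3] [cite: LangeBirkenhake1992, §1.2 Prop. 1.2.3] -/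
theorem _root_.Literature.AlgebraicGeometry.Motives.AbelianVariety.hom_eq_of_pullbackOne_eq {φ χ : A ⟶ A}
    (h : pullbackOne A φ = pullbackOne A χ) : φ = χ := by
  apply AbelianVariety.hom_eq_of_bettiCohomology_map_one_eq
  ext v
  apply ofRatClass_injective 1
  rw [ofRatClass_bettiMap, ofRatClass_bettiMap]
  exact LinearMap.congr_fun h (ofRatClass (ComplexPoints A.X) 1 v)

end Faithful

/-! ### §2 The algebra of Rosati pairs for a class `h` with non-degenerate `Q_h` -/

section Algebra

variable {A : AbelianVariety ℂ} {h : complexBetti A.X 2}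

/-- `Q_h` non-degenerate in the first variable is non-degenerate in the second (it is alternating). [folklore] -/
private theorem sepRight_of_hnd
    (hnd : ∀ x : complexBetti A.X 1, (∀ y, polarizationPairingOne A.X h (A.dim - 1) x y = 0) → x = 0)
    (y : complexBetti A.X 1) (hy : ∀ x, polarizationPairingOne A.X h (A.dim - 1) x y = 0) : y = 0 :=
  hnd y fun x ↦ by rw [polarizationPairingOne_swap h (A.dim - 1) x y, hy x, neg_zero]

/-- **THE ROSATI ADJOINT IS UNIQUE**: if `Q_h((kφ)^* x, y) = Q_h(x, φ'^* y) = Q_h(x, φ''^* y)` for all `x, y` and `Q_h`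
is non-degenerate, then `φ' = φ''`. [cite: MumfordAV1970, §20 pp. 189–190] [cite: LangeBirkenhake1992, §5.1 Prop. 5.1.1] -/
theorem rosati_adjoint_unique
    (hnd : ∀ x : complexBetti A.X 1, (∀ y, polarizationPairingOne A.X h (A.dim - 1) x y = 0) → x = 0)
    {φ₀ φ' φ'' : A ⟶ A}
    (hadj' : ∀ x y : complexBetti A.X 1, polarizationPairingOne A.X h (A.dim - 1) (pullbackOne A φ₀ x) y =
      polarizationPairingOne A.X h (A.dim - 1) x (pullbackOne A φ' y))
    (hadj'' : ∀ x y : complexBetti A.X 1, polarizationPairingOne A.X h (A.dim - 1) (pullbackOne A φ₀ x) y =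
      polarizationPairingOne A.X h (A.dim - 1) x (pullbackOne A φ'' y)) :
    φ' = φ'' := by
  apply AbelianVariety.hom_eq_of_pullbackOne_eq
  refine LinearMap.ext fun y ↦ sub_eq_zero.1 (sepRight_of_hnd hnd _ fun x ↦ ?_)
  rw [map_sub, sub_eq_zero, ← hadj' x y, ← hadj'' x y]

/-- **The swapped pair**: `Q_h((kφ)^* x, y) = Q_h(x, φ'^* y)` for all `x, y` iff `Q_h(φ'^* x, y) = Q_h(x, (kφ)^* y)` for all
`x, y` (`Q_h` is alternating) — the Rosati image of `φ'` is `kφ`: «`φ'' = φ`». [cite: MumfordAV1970, §20 pp. 189–190 (φ'' = φ)]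
[cite: LangeBirkenhake1992, §5.1 Thm. 5.1.8] -/
theorem rosati_adjoint_swap {φ₀ φ' : A ⟶ A}
    (hadj : ∀ x y : complexBetti A.X 1, polarizationPairingOne A.X h (A.dim - 1) (pullbackOne A φ₀ x) y =
      polarizationPairingOne A.X h (A.dim - 1) x (pullbackOne A φ' y)) (x y : complexBetti A.X 1) :
    polarizationPairingOne A.X h (A.dim - 1) (pullbackOne A φ' x) y =
      polarizationPairingOne A.X h (A.dim - 1) x (pullbackOne A φ₀ y) := by
  rw [polarizationPairingOne_swap h (A.dim - 1) y (pullbackOne A φ' x), ← hadj,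
    polarizationPairingOne_swap h (A.dim - 1) x (pullbackOne A φ₀ y), neg_neg]

/-- **Additivity**: Rosati pairs `(kφ₁, φ₁')`, `(kφ₂, φ₂')` with the same `k` give the pair `(k(φ₁ + φ₂), φ₁' + φ₂')`.
[cite: MumfordAV1970, §20 pp. 189–190] [cite: LangeBirkenhake1992, §5.1 Prop. 5.1.1] -/
theorem rosati_adjoint_add {k : ℤ} {φ₁ φ₁' φ₂ φ₂' : A ⟶ A}
    (h₁ : ∀ x y : complexBetti A.X 1, polarizationPairingOne A.X h (A.dim - 1) (pullbackOne A (k • φ₁) x) y =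
      polarizationPairingOne A.X h (A.dim - 1) x (pullbackOne A φ₁' y))
    (h₂ : ∀ x y : complexBetti A.X 1, polarizationPairingOne A.X h (A.dim - 1) (pullbackOne A (k • φ₂) x) y =
      polarizationPairingOne A.X h (A.dim - 1) x (pullbackOne A φ₂' y)) (x y : complexBetti A.X 1) :
    polarizationPairingOne A.X h (A.dim - 1) (pullbackOne A (k • (φ₁ + φ₂)) x) y =
      polarizationPairingOne A.X h (A.dim - 1) x (pullbackOne A (φ₁' + φ₂') y) := by
  rw [smul_add, pullbackOne_add_eq_add, pullbackOne_add_eq_add, LinearMap.add_apply, LinearMap.add_apply, map_add,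
    map_add, LinearMap.add_apply, h₁, h₂]

/-- **Integer scalars**: a Rosati pair `(kφ, φ')` gives the pair `(k(nφ), nφ')`. [cite: MumfordAV1970, §20 pp. 189–190] -/
theorem rosati_adjoint_zsmul {k : ℤ} {φ φ' : A ⟶ A} (n : ℤ)
    (hadj : ∀ x y : complexBetti A.X 1, polarizationPairingOne A.X h (A.dim - 1) (pullbackOne A (k • φ) x) y =
      polarizationPairingOne A.X h (A.dim - 1) x (pullbackOne A φ' y)) (x y : complexBetti A.X 1) :
    polarizationPairingOne A.X h (A.dim - 1) (pullbackOne A (k • (n • φ)) x) y =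
      polarizationPairingOne A.X h (A.dim - 1) x (pullbackOne A (n • φ') y) := by
  rw [smul_comm k n φ, pullbackOne_zsmul n (k • φ), pullbackOne_zsmul n φ', LinearMap.smul_apply, LinearMap.smul_apply,
    map_smul, map_smul, LinearMap.smul_apply, hadj]

/-- **Anti-multiplicativity**: Rosati pairs `(k₁φ₁, φ₁')`, `(k₂φ₂, φ₂')` give the pair `((k₁k₂)(φ₁ ≫ φ₂), φ₂' ≫ φ₁')`
(«`(φψ)' = ψ'φ'`»). [cite: MumfordAV1970, §20 pp. 189–190] [cite: LangeBirkenhake1992, §5.1 Thm. 5.1.8] -/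
theorem rosati_adjoint_comp {k₁ k₂ : ℤ} {φ₁ φ₁' φ₂ φ₂' : A ⟶ A}
    (h₁ : ∀ x y : complexBetti A.X 1, polarizationPairingOne A.X h (A.dim - 1) (pullbackOne A (k₁ • φ₁) x) y =
      polarizationPairingOne A.X h (A.dim - 1) x (pullbackOne A φ₁' y))
    (h₂ : ∀ x y : complexBetti A.X 1, polarizationPairingOne A.X h (A.dim - 1) (pullbackOne A (k₂ • φ₂) x) y =
      polarizationPairingOne A.X h (A.dim - 1) x (pullbackOne A φ₂' y)) (x y : complexBetti A.X 1) :
    polarizationPairingOne A.X h (A.dim - 1) (pullbackOne A ((k₁ * k₂) • (φ₁ ≫ φ₂)) x) y =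
      polarizationPairingOne A.X h (A.dim - 1) x (pullbackOne A (φ₂' ≫ φ₁') y) := by
  have e : (k₁ * k₂) • (φ₁ ≫ φ₂) = (k₁ • φ₁) ≫ (k₂ • φ₂) := by
    rw [Preadditive.zsmul_comp, Preadditive.comp_zsmul, smul_smul, mul_comm]
  rw [e, pullbackOne_comp_eq_mul, pullbackOne_comp_eq_mul, Module.End.mul_apply, Module.End.mul_apply, h₁, h₂]

/-- **Every integer `n·𝟙` is its own Rosati image** (the pair `(n·𝟙, n·𝟙)`, `k = 1`): the Rosati involution is
`ℚ`-linear and fixes `ℚ = ℚ·𝟙 ⊆ End⁰(A)` («`a' = a` for `a ∈ ℚ`»). [cite: MumfordAV1970, §20 pp. 189–190]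
[cite: LangeBirkenhake1992, §5.1 Prop. 5.1.1] -/
theorem rosati_adjoint_zsmul_id (n : ℤ) (x y : complexBetti A.X 1) :
    polarizationPairingOne A.X h (A.dim - 1) (pullbackOne A (n • 𝟙 A) x) y =
      polarizationPairingOne A.X h (A.dim - 1) x (pullbackOne A (n • 𝟙 A) y) := by
  rw [pullbackOne_zsmul, pullbackOne_id_eq_one, LinearMap.smul_apply, LinearMap.smul_apply, Module.End.one_apply,
    Module.End.one_apply, map_smul, LinearMap.smul_apply, map_smul]

/-- **Involutivity up to the integers**: if `(kφ, φ')` and `(k'φ', φ'')` are Rosati pairs then `φ'' = k'kφ`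
(uniqueness applied to the swapped pair). [cite: MumfordAV1970, §20 pp. 189–190 (φ'' = φ)] [cite: LangeBirkenhake1992, §5.1 Thm. 5.1.8] -/
theorem rosati_adjoint_rosati_adjoint
    (hnd : ∀ x : complexBetti A.X 1, (∀ y, polarizationPairingOne A.X h (A.dim - 1) x y = 0) → x = 0)
    {k k' : ℤ} {φ φ' φ'' : A ⟶ A}
    (hadj : ∀ x y : complexBetti A.X 1, polarizationPairingOne A.X h (A.dim - 1) (pullbackOne A (k • φ) x) y =
      polarizationPairingOne A.X h (A.dim - 1) x (pullbackOne A φ' y))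
    (hadj' : ∀ x y : complexBetti A.X 1, polarizationPairingOne A.X h (A.dim - 1) (pullbackOne A (k' • φ') x) y =
      polarizationPairingOne A.X h (A.dim - 1) x (pullbackOne A φ'' y)) :
    φ'' = k' • (k • φ) := by
  refine rosati_adjoint_unique hnd hadj' fun x y ↦ ?_
  have e := rosati_adjoint_zsmul (h := h) (k := (1 : ℤ)) (φ := φ') (φ' := k • φ) k'
    (fun a b ↦ by rw [one_smul]; exact rosati_adjoint_swap hadj a b) x y
  rwa [one_smul] at e

/-- **The integer of a Rosati pair can be taken positive**: from the pair `(kφ, φ')`, `k ≠ 0`, of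
`exists_rosati_adjoint_pullbackOne` one gets `(|k|φ, ±φ')`. [cite: MumfordAV1970, §20 pp. 189–190] -/
theorem exists_rosati_adjoint_pullbackOne_pos (h1 : 1 ≤ A.dim) (hQ : IsRationalClass h)
    (h11 : IsOfHodgeType A.dim A.X 2 1 1 h) (hHL : HasHardLefschetzProperty h A.dim) (φ : A ⟶ A) :
    ∃ (φ' : A ⟶ A) (k : ℤ), 0 < k ∧ ∀ x y : complexBetti A.X 1,
      polarizationPairingOne A.X h (A.dim - 1) (pullbackOne A (k • φ) x) y =
        polarizationPairingOne A.X h (A.dim - 1) x (pullbackOne A φ' y) := by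
  obtain ⟨φ', k, hk, hadj⟩ := exists_rosati_adjoint_pullbackOne h1 hQ h11 hHL φ
  rcases lt_or_gt_of_ne hk with hneg | hpos
  · refine ⟨(-1 : ℤ) • φ', -k, by omega, fun x y ↦ ?_⟩
    have e := rosati_adjoint_zsmul (h := h) (-1 : ℤ) hadj x y
    rwa [smul_smul, mul_neg, mul_one] at e
  · exact ⟨φ', k, hpos, hadj⟩

end Algebra

/-! ### §3 On the centre the Rosati adjoint does not depend on the polarization class -/

section Centre

variable {A : AbelianVariety ℂ} {h₁ h₂ : complexBetti A.X 2} {ψ ψ₁' ψ₂' : A ⟶ A} {R : Polynomial ℤ}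

/-- **THE ROSATI ADJOINT OF THE CENTRAL GENERATOR DOES NOT DEPEND ON THE POLARIZATION CLASS** — «`†` is complex
conjugation on `E`» for every polarization: if `h₁`, `h₂` are classes with non-degenerate, Hodge–Riemann positive
`Q_{h₁}`, `Q_{h₂}` on `H¹(A(ℂ); ℂ)`, `R(ψ) = 0` with `R` irreducible over `ℚ`, and `ψ₁', ψ₂' ∈ ℚ(ψ) ∩ End(A)`
(`Nᵢ ψᵢ' ∈ ℤ[ψ]`) are Rosati images of `ψ` for `h₁`, resp. `h₂`, then `ψ₁' = ψ₂'`: both `ψᵢ'^*` act on the eigenspace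
`V_τ(ψ)` by `τ̄` (the seat's `eigenspace_pullbackOne_adjoint_eq_eigenspace_conj`, Hodge–Riemann positivity), and
`H¹ = ⊕_τ V_τ(ψ)` (the tree's `iSup_eigenspace_pullbackOne_eq_top`).
[cite: Lange2023AbelianVarietiesC, §2.6 Lemma 2.6.6 and Thm. 2.6.8 (held p0144)] [cite: Shimura1998, §5.1 Lemma 2 and Proposition 5 (proof, pp. 35–36)]
[cite: MoonenZarhin1998WeilClasses, §1 (chunk p0002 L45–L51: «everything only depends on X up to isogeny»)] -/
theorem rosati_adjoint_central_eq_of_two_classes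
    (hnd₁ : ∀ x : complexBetti A.X 1, (∀ y, polarizationPairingOne A.X h₁ (A.dim - 1) x y = 0) → x = 0)
    (hposQ₁ : ∀ x ∈ hodgeOneZero (AbelianVariety.isSmoothProjective_holds (A := A)), x ≠ 0 →
      polarizationPairingOne A.X h₁ (A.dim - 1) x (conjClass (ComplexPoints A.X) 1 x) ≠ 0)
    (hnd₂ : ∀ x : complexBetti A.X 1, (∀ y, polarizationPairingOne A.X h₂ (A.dim - 1) x y = 0) → x = 0)
    (hposQ₂ : ∀ x ∈ hodgeOneZero (AbelianVariety.isSmoothProjective_holds (A := A)), x ≠ 0 →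
      polarizationPairingOne A.X h₂ (A.dim - 1) x (conjClass (ComplexPoints A.X) 1 x) ≠ 0)
    (hRirr : Irreducible (R.map (Int.castRingHom ℚ)))
    (hψR : Polynomial.eval₂ (Int.castRingHom (CategoryTheory.End A)) (ψ : CategoryTheory.End A) R = 0)
    (hadj₁ : ∀ x y : complexBetti A.X 1, polarizationPairingOne A.X h₁ (A.dim - 1) (pullbackOne A ψ x) y =
      polarizationPairingOne A.X h₁ (A.dim - 1) x (pullbackOne A ψ₁' y))
    (hψ₁'E : ∃ N : ℤ, N ≠ 0 ∧ End.of (N • ψ₁') ∈ Subring.closure {End.of ψ})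
    (hadj₂ : ∀ x y : complexBetti A.X 1, polarizationPairingOne A.X h₂ (A.dim - 1) (pullbackOne A ψ x) y =
      polarizationPairingOne A.X h₂ (A.dim - 1) x (pullbackOne A ψ₂' y))
    (hψ₂'E : ∃ N : ℤ, N ≠ 0 ∧ End.of (N • ψ₂') ∈ Subring.closure {End.of ψ}) :
    ψ₁' = ψ₂' := by
  apply AbelianVariety.hom_eq_of_pullbackOne_eq
  have hV₁ := eigenspace_pullbackOne_adjoint_eq_eigenspace_conj hnd₁ hposQ₁ hadj₁ hψ₁'E
  have hV₂ := eigenspace_pullbackOne_adjoint_eq_eigenspace_conj hnd₂ hposQ₂ hadj₂ hψ₂'E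
  -- both act on `V_τ(ψ)` by `τ̄`
  have hact : ∀ (τ : ℂ), ∀ v ∈ (pullbackOne A ψ).eigenspace τ, pullbackOne A ψ₁' v = pullbackOne A ψ₂' v := by
    intro τ v hv
    have hv₁ : v ∈ (pullbackOne A ψ₁').eigenspace (starRingEnd ℂ τ) := by rw [hV₁, starRingEnd_self_apply]; exact hv
    have hv₂ : v ∈ (pullbackOne A ψ₂').eigenspace (starRingEnd ℂ τ) := by rw [hV₂, starRingEnd_self_apply]; exact hv
    rw [Module.End.mem_eigenspace_iff.1 hv₁, Module.End.mem_eigenspace_iff.1 hv₂]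
  -- and `H¹ = ⊕_τ V_τ(ψ)`
  have htop := iSup_eigenspace_pullbackOne_eq_top hRirr hψR
  have hle : (⨆ μ, (pullbackOne A ψ).eigenspace μ) ≤ LinearMap.ker (pullbackOne A ψ₁' - pullbackOne A ψ₂') :=
    iSup_le fun τ w hw ↦ by
      rw [LinearMap.mem_ker, LinearMap.sub_apply, sub_eq_zero]
      exact hact τ w hw
  refine LinearMap.ext fun v ↦ ?_
  have hv : v ∈ LinearMap.ker (pullbackOne A ψ₁' - pullbackOne A ψ₂') := hle (by rw [htop]; exact Submodule.mem_top)
  rwa [LinearMap.mem_ker, LinearMap.sub_apply, sub_eq_zero] at hv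

/-- **… FOR TWO POLARIZATION CLASSES AND THE `End(A)`-LEVEL PRESENTATION OF THE CENTRE**: `h₁`, `h₂` rational, of
type `(1,1)`, hard Lefschetz, Hodge–Riemann positive on `H^{1,0}` (`dim A ≥ 1`); `ψ` central with `R(ψ) = 0`, `R`
irreducible over `ℚ`, every central `g` with `N g ∈ ℤ[ψ]`; `(ψ, ψ₁')` a `Q_{h₁}`-Rosati pair and `(ψ, ψ₂')` a
`Q_{h₂}`-Rosati pair.  Then `ψ₁' = ψ₂'` — the `ψᵢ'` are central (g28-#2's `comp_comm_of_rosati_adjoint`), so lie in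
`ℚ(ψ)`, and the previous theorem applies.
[cite: Lange2023AbelianVarietiesC, §2.6 Lemma 2.6.6 and Thm. 2.6.8 (held p0144)] [cite: Shimura1998, §5.1 Lemma 2 and Proposition 5 (proof, pp. 35–36)]
[cite: MumfordAV1970, §20 pp. 189–190] -/
theorem rosati_adjoint_central_eq_of_two_polarizationClasses (h1 : 1 ≤ A.dim)
    (hQ₁ : IsRationalClass h₁) (h11₁ : IsOfHodgeType A.dim A.X 2 1 1 h₁) (hHL₁ : HasHardLefschetzProperty h₁ A.dim)
    (hposQ₁ : ∀ x ∈ hodgeOneZero (AbelianVariety.isSmoothProjective_holds (A := A)), x ≠ 0 →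
      polarizationPairingOne A.X h₁ (A.dim - 1) x (conjClass (ComplexPoints A.X) 1 x) ≠ 0)
    (hQ₂ : IsRationalClass h₂) (h11₂ : IsOfHodgeType A.dim A.X 2 1 1 h₂) (hHL₂ : HasHardLefschetzProperty h₂ A.dim)
    (hposQ₂ : ∀ x ∈ hodgeOneZero (AbelianVariety.isSmoothProjective_holds (A := A)), x ≠ 0 →
      polarizationPairingOne A.X h₂ (A.dim - 1) x (conjClass (ComplexPoints A.X) 1 x) ≠ 0)
    (hψ : ∀ χ : A ⟶ A, ψ ≫ χ = χ ≫ ψ) (hRirr : Irreducible (R.map (Int.castRingHom ℚ)))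
    (hψR : Polynomial.eval₂ (Int.castRingHom (CategoryTheory.End A)) (ψ : CategoryTheory.End A) R = 0)
    (hZ : ∀ g : A ⟶ A, (∀ χ : A ⟶ A, g ≫ χ = χ ≫ g) →
      ∃ N : ℤ, N ≠ 0 ∧ End.of (N • g) ∈ Subring.closure {End.of ψ})
    (hadj₁ : ∀ x y : complexBetti A.X 1, polarizationPairingOne A.X h₁ (A.dim - 1) (pullbackOne A ψ x) y =
      polarizationPairingOne A.X h₁ (A.dim - 1) x (pullbackOne A ψ₁' y))
    (hadj₂ : ∀ x y : complexBetti A.X 1, polarizationPairingOne A.X h₂ (A.dim - 1) (pullbackOne A ψ x) y =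
      polarizationPairingOne A.X h₂ (A.dim - 1) x (pullbackOne A ψ₂' y)) :
    ψ₁' = ψ₂' :=
  rosati_adjoint_central_eq_of_two_classes
    (fun _ hx ↦ eq_zero_of_forall_polarizationPairingOne_eq_zero_of_hasHardLefschetzProperty h1 hHL₁ hx) hposQ₁
    (fun _ hx ↦ eq_zero_of_forall_polarizationPairingOne_eq_zero_of_hasHardLefschetzProperty h1 hHL₂ hx) hposQ₂
    hRirr hψR hadj₁ (exists_zsmul_rosati_adjoint_mem_closure h1 hQ₁ h11₁ hHL₁ hψ hadj₁ hZ) hadj₂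
    (exists_zsmul_rosati_adjoint_mem_closure h1 hQ₂ h11₂ hHL₂ hψ hadj₂ hZ)

end Centre

/-! ### §4 No factor of type IV iff the Rosati adjoint is the identity on the centre -/

section FirstKind

variable {A : AbelianVariety ℂ} {h : complexBetti A.X 2}

/-- **`A` HAS NO FACTOR OF TYPE IV iff THE ROSATI ADJOINT IS THE IDENTITY ON THE CENTRE OF `End(A)`** — «types I–III:
the anti-involution is of the first kind, i.e. trivial on the centre» (Lange §2.6), for ANY polarization class `h`
(rational, `(1,1)`, hard Lefschetz, Hodge–Riemann positive on `H^{1,0}`; `dim A ≥ 1`): `HasNoTypeIVFactor A` iff every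
Rosati pair `(kφ, φ')` with `φ` central has `φ' = kφ`.  (`⟹`: central pull-backs are `Q_h`-self-adjoint, the tree's
`hasNoTypeIVFactor_iff_forall_central_pullbackOne_isSelfAdjoint`, and uniqueness §2; `⟸`: every central `φ` has a
Rosati pair by g28-#2's `exists_rosati_adjoint_pullbackOne`, so `(kφ)^*` is self-adjoint and the scalar cancels.)
[cite: Lange2023AbelianVarietiesC, §2.6 (first/second kind; Lemma 2.6.4, Lemma 2.6.6, held p0144)]
[cite: LangeBirkenhake1992, §5.5] [cite: MoonenZarhin1999LowDim, §1] [cite: MumfordAV1970, §20 pp. 189–190] -/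
theorem hasNoTypeIVFactor_iff_forall_central_rosati_adjoint_eq (h1 : 1 ≤ A.dim) (hQ : IsRationalClass h)
    (h11 : IsOfHodgeType A.dim A.X 2 1 1 h) (hHL : HasHardLefschetzProperty h A.dim)
    (hposQ : ∀ x ∈ hodgeOneZero (AbelianVariety.isSmoothProjective_holds (A := A)), x ≠ 0 →
      polarizationPairingOne A.X h (A.dim - 1) x (conjClass (ComplexPoints A.X) 1 x) ≠ 0) :
    HasNoTypeIVFactor A ↔ ∀ (φ φ' : A ⟶ A) (k : ℤ), (∀ χ : A ⟶ A, φ ≫ χ = χ ≫ φ) →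
      (∀ x y : complexBetti A.X 1, polarizationPairingOne A.X h (A.dim - 1) (pullbackOne A (k • φ) x) y =
        polarizationPairingOne A.X h (A.dim - 1) x (pullbackOne A φ' y)) → φ' = k • φ := by
  have hnd : ∀ x : complexBetti A.X 1, (∀ y, polarizationPairingOne A.X h (A.dim - 1) x y = 0) → x = 0 :=
    fun _ hx ↦ eq_zero_of_forall_polarizationPairingOne_eq_zero_of_hasHardLefschetzProperty h1 hHL hx
  have hiff := hasNoTypeIVFactor_iff_forall_central_pullbackOne_isSelfAdjoint h1 hQ h11 hHL hposQ
  refine ⟨fun h4 φ φ' k hφ hadj ↦ ?_, fun H ↦ hiff.2 fun u huC x y ↦ ?_⟩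
  · -- `kφ` is central, hence `Q_h`-self-adjoint; uniqueness of the adjoint
    have hkφ : ∀ χ : A ⟶ A, χ ≫ (k • φ) = (k • φ) ≫ χ := fun χ ↦ by
      rw [Preadditive.comp_zsmul, Preadditive.zsmul_comp, hφ χ]
    exact rosati_adjoint_unique hnd hadj (hiff.1 h4 (k • φ) (pullbackOne_mem_centralizerAlgebra_of_comp_comm hkφ))
  · -- a Rosati pair `(ku, u')` exists; by hypothesis `u' = ku`, and the scalar `k ≠ 0` cancels
    have hu : ∀ χ : A ⟶ A, u ≫ χ = χ ≫ u := fun χ ↦ (comp_comm_of_pullbackOne_mem_centralizerAlgebra huC χ).symm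
    obtain ⟨u', k, hk, hadj⟩ := exists_rosati_adjoint_pullbackOne h1 hQ h11 hHL u
    have hu' : u' = k • u := H u u' k hu hadj
    have e := hadj x y
    rw [hu', pullbackOne_zsmul, LinearMap.smul_apply, LinearMap.smul_apply, map_smul, map_smul,
      LinearMap.smul_apply] at e
    exact smul_right_injective _ (Int.cast_ne_zero.2 hk) e

/-- **… equivalently `A` HAS A FACTOR OF TYPE IV iff SOME CENTRAL `φ` IS MOVED BY THE ROSATI ADJOINT** (`φ' ≠ kφ` for
its Rosati pair) — «type IV: the anti-involution is of the second kind».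
[cite: Lange2023AbelianVarietiesC, §2.6 Lemma 2.6.6 (held p0144)] [cite: LangeBirkenhake1992, §5.5] -/
theorem not_hasNoTypeIVFactor_iff_exists_central_rosati_adjoint_ne (h1 : 1 ≤ A.dim) (hQ : IsRationalClass h)
    (h11 : IsOfHodgeType A.dim A.X 2 1 1 h) (hHL : HasHardLefschetzProperty h A.dim)
    (hposQ : ∀ x ∈ hodgeOneZero (AbelianVariety.isSmoothProjective_holds (A := A)), x ≠ 0 →
      polarizationPairingOne A.X h (A.dim - 1) x (conjClass (ComplexPoints A.X) 1 x) ≠ 0) :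
    ¬ HasNoTypeIVFactor A ↔ ∃ (φ φ' : A ⟶ A) (k : ℤ), (∀ χ : A ⟶ A, φ ≫ χ = χ ≫ φ) ∧
      (∀ x y : complexBetti A.X 1, polarizationPairingOne A.X h (A.dim - 1) (pullbackOne A (k • φ) x) y =
        polarizationPairingOne A.X h (A.dim - 1) x (pullbackOne A φ' y)) ∧ φ' ≠ k • φ := by
  rw [hasNoTypeIVFactor_iff_forall_central_rosati_adjoint_eq h1 hQ h11 hHL hposQ]
  push Not
  rfl

end FirstKind

end Literature.AlgebraicGeometry.HodgeTheory

end
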